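import Mathlib
import Literature.NumberTheory.Transcendental.SemialgebraicAlgebraicPoints
import Summits.KontsevichZagierPeriods.KontsevichZagierPeriods.Theorems.InverseLandauTateLiftingDimZeroLift

/-!
# `TateLifting` (stmt-KontsevichZagierPeriods-9129), line `Sketch` — stub `stub_dimZeroLiftAlg`

UNCONDITIONAL DIMENSION-ZERO LIFT. Every integral representation `r` of dimension `0` (no
KZ-rationality hypothesis) differs by relations of the Kontsevich–Zagier calculus from a
representation `ρ` of dimension `1` whose integrand is, on its domain, a quotient `p/q` of real
polynomials in one variable with real-algebraic coefficients (`q` non-vanishing on the domain).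

The space `ℝ⁰ = (Fin 0 → ℝ)` is one point, so `r.domain` is either empty or the whole space.

* Full domain: the value `a := r.integrand pt` is ALGEBRAIC over `ℚ`, being the value of the
  `ℚ`-semialgebraic function `r.integrand` at the (vacuously algebraic) point of `ℝ⁰`
  (`IsSemialgebraicFunOn.isAlgebraic_apply`, Tarski–Seidenberg). We take for `ρ` the tame closed
  cube `[[0,1]¹, a]` with the constant integrand `a = C a / 1`; the difference `[r] − [ρ]` is a
  relation through the tame cube `[[0,1]⁰, a]`: congruence on `ℝ⁰ = [0,1]⁰`
  (`KZ.of_sub_of_mem_relations_of_eqOn`) and one Newton–Leibniz move ignoring the last coordinate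
  of a tame cube (`TateFamilyKernel.tame_liftLast`).
* Empty domain: `[r]` is a relation (`DimOne.dz_of_mem_relations_of_not_mem`), and so is the tame
  cube `[[0,1]¹, 0]` with the zero integrand `0 = C 0 / 1` (`KZ.of_mem_relations_of_eqOn_zero`).

References: M. Kontsevich, D. Zagier, *Periods* (2001), §1.1 ("rational" may be replaced by
"algebraic") and §1.2, rules (1) and (3).
-/

noncomputable section

open MeasureTheory Set
open Literature.ModelTheory.ExponentialFields (IsSemialgebraic)
open Literature.NumberTheory.Transcendental

namespace Summit.KontsevichZagierPeriods.InverseLandau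

namespace DimOne

/-! ### Dimension-zero helpers, algebraic version (`dzl_`) -/

/-- **The value of a dimension-zero representation at the point of its domain is algebraic**: the
integrand is a `ℚ`-semialgebraic function on the domain, and the point of `ℝ⁰` has (vacuously)
algebraic coordinates. [cite: KontsevichZagier2001, §1.1] -/
theorem dzl_isAlgebraic_integrand (r : KZ.IntegralRep 0) (h0 : (default : Fin 0 → ℝ) ∈ r.domain) :
    IsAlgebraic ℚ (r.integrand default) :=
  r.isSemialgebraicFunOn_integrand.isAlgebraic_apply h0 fun i => i.elim0

/-- **The two tame constant cubes `[[0,1]¹, a]` and `[[0,1]⁰, a]`** of a real-algebraic constant `a`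
differ by a relation (one Newton–Leibniz move ignoring the last coordinate,
`TateFamilyKernel.tame_liftLast`). [cite: KontsevichZagier2001, §1.2] -/
theorem dzl_exists_tameCube_const {a : ℝ} (ha : IsAlgebraic ℚ a) :
    ∃ (U : KZ.IntegralRep 1) (u0 : KZ.IntegralRep 0),
      U.integrand = (fun _ => a) ∧ u0.domain = Set.univ ∧ u0.integrand = (fun _ => a) ∧
      KZ.of U - KZ.of u0 ∈ KZ.relations := by
  have hUs : IsSemialgebraicFunOn ℚ (KZ.cube 1) (fun _ : Fin 1 → ℝ => a) :=
    isSemialgebraicFunOn_const_of_isAlgebraic KZ.isSemialgebraic_cube ha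
  have hus : IsSemialgebraicFunOn ℚ (KZ.cube 0) (fun _ : Fin 0 → ℝ => a) :=
    isSemialgebraicFunOn_const_of_isAlgebraic KZ.isSemialgebraic_cube ha
  refine ⟨KZ.IntegralRep.tameCube (fun _ : Fin 1 → ℝ => a) (dz_analyticOnNhd_const a) hUs,
    KZ.IntegralRep.tameCube (fun _ : Fin 0 → ℝ => a) (dz_analyticOnNhd_const a) hus, rfl, ?_, rfl,
    ?_⟩
  · rw [KZ.IntegralRep.tameCube_domain, KZ.cube_zero]
  · exact TateFamilyKernel.tame_liftLast (dz_analyticOnNhd_const a) hus _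
      (KZ.IntegralRep.isTameCube_tameCube _ _ _) (fun _ _ => rfl) _
      (KZ.IntegralRep.isTameCube_tameCube _ _ _) (fun _ _ => rfl)

/-- **Algebraic reading of a constant integrand**: a representation of dimension `1` with constant
integrand `a`, `a` real-algebraic, has integrand `C a / 1` on its domain, a quotient of real
polynomials with algebraic coefficients and non-vanishing denominator. [folklore] -/
theorem dzl_exists_algReading_const {a : ℝ} (ha : IsAlgebraic ℚ a) (ρ : KZ.IntegralRep 1)
    (hρ : ρ.integrand = fun _ => a) :
    ∃ p q : Polynomial ℝ, (∀ i, IsAlgebraic ℚ (p.coeff i)) ∧ (∀ i, IsAlgebraic ℚ (q.coeff i)) ∧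
      (∀ x ∈ ρ.domain, q.eval (x 0) ≠ 0) ∧
      Set.EqOn ρ.integrand (fun x => p.eval (x 0) / q.eval (x 0)) ρ.domain := by
  refine ⟨Polynomial.C a, 1, fun i => ?_, fun i => ?_, fun x _ => ?_, fun x _ => ?_⟩
  · rw [Polynomial.coeff_C]
    split_ifs
    exacts [ha, isAlgebraic_zero]
  · rw [Polynomial.coeff_one]
    split_ifs
    exacts [isAlgebraic_one, isAlgebraic_zero]
  · rw [Polynomial.eval_one]
    exact one_ne_zero
  · simp [hρ]

end DimOne

/-- **Unconditional dimension-zero lift** (stub `stub_dimZeroLiftAlg` of the lead's skeleton, the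
body of `DimZeroLiftAlg`): every representation of dimension `0` — an arbitrary `ℚ`-semialgebraic
constant over the point `ℝ⁰`, whose value is therefore real-algebraic, or the empty domain — differs
by relations of the Kontsevich–Zagier calculus from a representation of dimension `1` with integrand
a quotient of real polynomials with algebraic coefficients (`[[0,1], a]`, `a = C a / 1`: congruence
over the point and one Newton–Leibniz move lifting the constant to the closed unit interval; for the
empty domain both `[r]` and the zero cube `[[0,1], 0]` are relations).
[cite: KontsevichZagier2001, §1.2] -/
theorem tateLifting_dimZeroLiftAlg :
    ∀ r : KZ.IntegralRep 0, ∃ (ρ : KZ.IntegralRep 1) (p q : Polynomial ℝ),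
      (∀ i, IsAlgebraic ℚ (p.coeff i)) ∧ (∀ i, IsAlgebraic ℚ (q.coeff i)) ∧
      (∀ x ∈ ρ.domain, q.eval (x 0) ≠ 0) ∧
      Set.EqOn ρ.integrand (fun x => p.eval (x 0) / q.eval (x 0)) ρ.domain ∧
      KZ.of r - KZ.of ρ ∈ KZ.relations := by
  intro r
  by_cases h0 : (default : Fin 0 → ℝ) ∈ r.domain
  · -- full domain: the value `a = r.integrand pt` is algebraic
    have ha : IsAlgebraic ℚ (r.integrand default) := DimOne.dzl_isAlgebraic_integrand r h0
    obtain ⟨U, u0, hUi, hu0d, hu0i, h1⟩ := DimOne.dzl_exists_tameCube_const ha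
    obtain ⟨p, q, hp, hq, hq0, hpq⟩ := DimOne.dzl_exists_algReading_const ha U hUi
    refine ⟨U, p, q, hp, hq, hq0, hpq, ?_⟩
    have hdom : r.domain = Set.univ :=
      Set.eq_univ_of_forall fun x => (Subsingleton.elim default x) ▸ h0
    have h2 : KZ.of r - KZ.of u0 ∈ KZ.relations :=
      KZ.of_sub_of_mem_relations_of_eqOn (by rw [hdom, hu0d]) fun x _ => by
        rw [hu0i, Subsingleton.elim x default]
    have : KZ.of r - KZ.of U = (KZ.of r - KZ.of u0) - (KZ.of U - KZ.of u0) := by abel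
    rw [this]
    exact KZ.relations.sub_mem h2 h1
  · -- empty domain: `[r]` and the zero cube `[[0,1], 0]` are relations
    obtain ⟨U, u0, hUi, -, -, -⟩ :=
      DimOne.dzl_exists_tameCube_const (isAlgebraic_zero (R := ℚ) (A := ℝ))
    obtain ⟨p, q, hp, hq, hq0, hpq⟩ := DimOne.dzl_exists_algReading_const isAlgebraic_zero U hUi
    refine ⟨U, p, q, hp, hq, hq0, hpq, ?_⟩
    exact KZ.relations.sub_mem (DimOne.dz_of_mem_relations_of_not_mem r h0)
      (KZ.of_mem_relations_of_eqOn_zero U fun x _ => by simp only [hUi, Pi.zero_apply])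

end Summit.KontsevichZagierPeriods.InverseLandau

end
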